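import Summits.BirchSwinnertonDyer.Rank1Residual.P2.CongruentNumberHalvingChainTwoDescent
import Summits.BirchSwinnertonDyer.Rank1Residual.P2.CongruentNumberHalvingBitsPairKit
import HarnessLib

/-!
# Sub-lane «bsd-p2»: the HALVING CHAIN ON COORDINATES — the chain-form door
# (`P2/CongruentNumberHalvingChainTwoDescent.lean`) assembled through the (ε′) per-pair kit
# (`P2/CongruentNumberHalvingBitsPairKit.lean`): uniform in `k ≥ 2`:
# ONE `(k−2)`-fold half `R` by coordinates + four non-squares (`k = 3`: one half, no square-root
# witness; `k = 4`: `R = R₁`, the `b₂ ∧ ¬ b₃` certificate on numerals) — 0 def; 0 facts; 0 (K); no pair,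
# no numeral of a census cell

HONEST FRAMING (sub-lane «bsd-p2», run/shared/lean/b2b/bsd-rank1-residual/p2/, verbatim in every
file): the target of record is the FULL Birch–Swinnerton-Dyer formula for EVERY analytic-rank `≤ 1`
`E/ℚ` at ALL primes INCLUDING `2`; the odd-prime class ledger is referee A's; the `2`-part is OPEN
(cells O1 = X5 ∖ CM and O12 = the CM corner) and under census by «bsd-p2». Census / instrument
output at `2` = EVIDENCE / conjecture items with held-out validation, NEVER a Literature fact;
certificates close PAIRS (one isogeny class, `p = 2`), never classes. THIS FILE is unconditional
bookkeeping: the ONE assembly theorem below (binder `k`; p2-lead GEN 8 T-149 rail (a): never one per `k`)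
only COMPOSES the chain-form door (`rankOne_sha_bsdp_two_of_pow_nsmul_eq_congruentNumberCurve_two_mul_prod`)
with the kit's coordinate lemmas (`two_nsmul_some_ne_zero_congruentNumberCurve`, `forall_two_torsion_twoDescentMap_ne_of_not_isSquare`).
It closes NO pair, states no conjecture, adds no fact, touches no (K) / mark / tier; a pair assembled
through it is «`BSD₂(E_n)` modulo the DISPLAYED `T_even(n)` hypothesis `hT` (PRINTED-ASSERTED: LEMMA
(I)-even ∘ Tian–Yuan–Zhang 2017 Thm 3.3, never discharged in the tree), `hGZK`, `hMe`» — never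
unconditional. NO `ℓ = 4` cell, point or numeral appears here or was computed for this file (the lane's
PT17A blind regime is untouched). LANDING ORDER (if ever ruled): after BOTH imports exist in the tree
(the kit = p2-lead GEN 8 BATCH 46 (b) name; the chain file = p2-typer GEN 18 scratch); its body is
validated byte-identically inside `HalvingChainKit.combined-validation.scratch.lean` (rc 0). Unit
`b2b-bsdres-p2-typer` GEN 18 — SCRATCH (zero-proposal desk prep for the SWEEP 2026-08-24; p2-lead GEN 8
BATCH 46 (c): nothing proposed before the SWEEP word).

References: [SilvermanAEC2009] Group Law Algorithm III.2.3, Prop. X.1.4; [Knapp1993] Lemma 4.20;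
[Monsky1990MockHeegner] Remark (3) (p. 67); [Miller2011LMS] Def. 1.1; HOME
`p2/lead/PR-P2-7-CHARTER-PREDRAFT-GEN8.md` §2; `p2/LEAD-OKS.md` § GEN 7 BATCH 42, § GEN 8 BATCH 45–48.
-/

noncomputable section

open WeierstrassCurve WeierstrassCurve.Affine WeierstrassCurve.Affine.Point
  Literature.NumberTheory.EllipticCurves Literature.NumberTheory.EllipticCurves.TwoDescentLocal
  Literature.NumberTheory.EllipticCurves.Rank1Residual
  Literature.NumberTheory.EllipticCurves.Rank1Residual.Typed
  Literature.NumberTheory.EllipticCurves.HeathBrown1994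

set_option autoImplicit false

namespace Summit.BirchSwinnertonDyer.Rank1Residual.P2

/-! ## §1 Coordinate-level assembly through the (ε′) kit (`P2/CongruentNumberHalvingBitsPairKit.lean`,
ruled name of `CongruentNumberSquareClassHelpers.scratch.lean` @1631de2bbe55b79f; lands AFTER it),
uniform in `k ≥ 2`: `s`, ONE `(k−2)`-fold half `R` by coordinates, four non-squares — every remaining
per-pair obligation a rational identity / non-square closed by `norm_num` (no pair instantiated here) -/

section Coordinates

variable [inst : DecidableEq ℚ] {k : ℕ} (p : Fin k → ℕ)

/-- **COORDINATE-LEVEL ASSEMBLY, uniform in `k ≥ 2` (modulo `hGZK`, `hMe` and the DISPLAYED `hT`).**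
The chain-form door `rankOne_sha_bsdp_two_of_pow_nsmul_eq_congruentNumberCurve_two_mul_prod` with its
inputs supplied from coordinates: the even cell data (`p : Fin k → ℕ` prime, injective,
`2∏p = n ≡ 6 (mod 8)`, `s(n) = monskySelmerRankEven p = 1` by `monskySelmerRankEven_eq_of_table` + one
kernel count); `s = (x_s, y_s) ∈ E_n(ℚ)` with `y_s ≠ 0` (so `2 • s ≠ O`); the displayed
`hT : L′(E_n, 1) = 4·Ω·ĥ(s)`; ONE point `R = (x_R, y_R)` (`y_R ≠ 0`) with `2^{k−2} • R = s + T₀` for a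
`2`-torsion `T₀` — per pair: `k − 2` displayed doublings `2 • R₀ = s + T₀`, `2 • R_{i+1} = R_i + T_{i+1}`
(kit §1: a tangent, plus a chord when `Tᵢ ≠ O`, every identity by `norm_num`), folded by
`pow_nsmul_eq_of_two_nsmul_eq`; and four non-square witnesses putting `δ R = (x_R + n, x_R)` outside
`δ(E_n[2]) = {(1, 1), (2n², −n), (n, −n²), (2n, n)}`. THEN
`ord_{s=1} L(E_n, s) = 1 ∧ rank 1 ∧ Ш(E_n)[2^∞] = 0 ∧ BSD(E_n, 2)` — «`BSD₂(E_n)` modulo `T_even(n)`, GZK,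
Monsky's even matrix theorem», nothing more; closes no class. At `k = 3` this is the (ε′) kit's §3
WITHOUT its `b₁` square-root inputs `(c₁, c₂, r₁, r₂, hc, e₁, e₂)`; at `k = 4` it is the `b₂ ∧ ¬ b₃`
certificate on numerals (`R = R₁`). NO cell is instantiated in this file.
[cite: Monsky1990MockHeegner, Remark (3) (p. 67)] [cite: SilvermanAEC2009, Prop. X.1.4]
[cite: Miller2011LMS, Def. 1.1 (arXiv:1010.2431 p. 3)] -/
theorem rankOne_sha_bsdp_two_of_coordinates_pow_nsmul_eq_congruentNumberCurve_two_mul_prod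
    (hGZK : rank_eq_analyticRank_of_analyticRank_le_one) (hMe : monsky_card_selmerGroup_two_even)
    (hk : 2 ≤ k) (hp : ∀ i, (p i).Prime) (hinj : Function.Injective p) {n : ℕ}
    (hn : 2 * ∏ i, p i = n) (h8 : n % 8 = 6) (hs : monskySelmerRankEven p = 1) (hn0 : n ≠ 0)
    {xs ys : ℚ} (hs_on : (congruentNumberCurve n).toAffine.Nonsingular xs ys) (hys : ys ≠ 0)
    (hT : deriv (congruentNumberCurve n).entireLFunction 1 =
      (4 : ℂ) * ((congruentNumberCurve n).realPeriodRat : ℂ) *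
        ((Point.some xs ys hs_on : (congruentNumberCurve n).toAffine.Point).canonicalHeight : ℂ))
    {xR yR : ℚ} (hR_on : (congruentNumberCurve n).toAffine.Nonsingular xR yR) (hyR : yR ≠ 0)
    (T₀ : (congruentNumberCurve n).toAffine.Point) (hT₀ : (2 : ℕ) • T₀ = 0)
    (hR : (2 ^ (k - 2) : ℕ) • (Point.some xR yR hR_on : (congruentNumberCurve n).toAffine.Point) =
      Point.some xs ys hs_on + T₀)
    (h1 : ¬ IsSquare (xR + n) ∨ ¬ IsSquare xR)
    (h2 : ¬ IsSquare ((xR + n) * (2 * (n : ℚ) ^ 2)) ∨ ¬ IsSquare (xR * -(n : ℚ)))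
    (h3 : ¬ IsSquare ((xR + n) * (n : ℚ)) ∨ ¬ IsSquare (xR * -(n : ℚ) ^ 2))
    (h4 : ¬ IsSquare ((xR + n) * (2 * (n : ℚ))) ∨ ¬ IsSquare (xR * (n : ℚ))) :
    (congruentNumberCurve n).analyticRank = 1 ∧ (congruentNumberCurve n).mordellWeilRank = 1 ∧
      AddCommGroup.primaryComponent (congruentNumberCurve n).sha 2 = ⊥ ∧
      BSDp (congruentNumberCurve n) 2 :=
  rankOne_sha_bsdp_two_of_pow_nsmul_eq_congruentNumberCurve_two_mul_prod p hGZK hMe hk hp hinj hn h8 hs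
    hn0 (Point.some xs ys hs_on) (two_nsmul_some_ne_zero_congruentNumberCurve hn0 hs_on hys) hT
    (Point.some xR yR hR_on) T₀ hT₀ hR
    (forall_two_torsion_twoDescentMap_ne_of_not_isSquare hn0 hR_on hyR h1 h2 h3 h4)

end Coordinates

end Summit.BirchSwinnertonDyer.Rank1Residual.P2

end
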